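import Summits.QuantumFields.YangMills.Theorems.NPointIsotropy.Negative.NPointRegularJunk
import Summits.QuantumFields.YangMills.Theorems.PencilRigidityNPointIsotropyMopupHelpers
import Literature.MathematicalPhysics.QuantumLattice.SchwingerOSPositivity

/-!
# `PencilRigidity.NPointIsotropy`, line `quarter-turn-corner-operator`: helpers for stub `stub_unorderedRP`, I
# (off-diagonality of OS tensors and the E3 transport of the OS pairing)

Support file (helpers, part I) for stub `stub_unorderedRP` (B1, unordered reflection positivity on `⁰𝒮` from the
function residual) of crux `stmt-QuantumFields-11686` (`Summit.QuantumFields.YangMills.Theses.PencilRigidity.NPointIsotropy`),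
line `quarter-turn-corner-operator`. Everything lives in the sub-namespace `…NPointIsotropy.QuarterTurnCornerOperator`
(helpers in `…QuarterTurnCornerOperator.UnorderedRP`); no `def`.

Contents (`E4 = ℝ⁴`, configurations `x : Fin n → E4`, time = coordinate `0`):
* flatness bookkeeping: a product `f·g` of smooth functions is flat (all derivatives vanish) at a point where one
  factor is flat (Leibniz bound `norm_iteratedFDeriv_mul_le`); flatness passes through precomposition with a
  continuous linear map (`ContinuousLinearMap.iteratedFDeriv_comp_right`);
* `⁰𝒮` (`IsOffDiagonal`) is stable under complex conjugation `starTest`, permutations `permTest σ` and the OS adjoint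
  `osAdjoint = starTest ∘ Θ ∘ permTest rev`;
* **OS tensors of off-diagonal positive-time functions are off-diagonal**
  (`isOffDiagonal_osAdjoint_appendTensor`): for `A ∈ ⁰𝒮ₙ`, `B ∈ ⁰𝒮ₘ` supported in `{∀ i, xᵢ⁰ > 0}` (UNORDERED
  `𝒮₊`, not OS's time-ordered `𝒮_<`), `ΘA* ⊗ B ∈ ⁰𝒮ₙ₊ₘ`: a coincidence `x_p = x_q` inside one block is a coincidence of
  that block, where the factor is flat; across the blocks it forces `x_p⁰ < 0 < x_q⁰ = x_p⁰` on the support;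
* **E3 transport of the OS pairing** (`osPairing_permTest`): `Θ(A^σ)* = (ΘA*)^{rev σ rev}` and
  `A'^{σ'} ⊗ B^τ = (A' ⊗ B)^{σ' ⊕ τ}`, so symmetry E3 on `⁰𝒮` gives `⟪A^σ, B^τ⟫_S = ⟪A, B⟫_S` whenever
  `ΘA* ⊗ B ∈ ⁰𝒮`; and the coefficient-free sesquilinearity `osPairing_sum_sum`.
The registered sub-goal `unorderedRPTransport` bundles the last two items.

References: K. Osterwalder, R. Schrader, Comm. Math. Phys. 31 (1973) §2 (`f*`, `Θ`, `f^π`), §3 (E3); folklore.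
-/

noncomputable section

namespace Summit.QuantumFields.YangMills.Theorems.NPointIsotropy.QuarterTurnCornerOperator

open scoped BigOperators SchwartzMap ComplexConjugate ContDiff
open MeasureTheory Filter Topology
open Literature.MathematicalPhysics.QuantumLattice Literature.MathematicalPhysics.AQFT
  Literature.MathematicalPhysics.QuantumFieldTheory
open Summit.QuantumFields.YangMills.Theorems.NPointIsotropy.Negative (E4)
open Summit.QuantumFields.YangMills.Theorems.CurvatureBoostCovariance.Negative (isOffDiagonal_linActMulti)

namespace UnorderedRP

variable {n m : ℕ}

/-! ## Flatness bookkeeping -/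

/-- A product of smooth functions is flat at a point where the left factor is flat (Leibniz bound). [folklore] -/
theorem iteratedFDeriv_mul_eq_zero_of_left {X : Type*} [NormedAddCommGroup X] [NormedSpace ℝ X]
    {f g : X → ℂ} {x : X} (hf : ContDiff ℝ ∞ f) (hg : ContDiff ℝ ∞ g)
    (h0 : ∀ k, iteratedFDeriv ℝ k f x = 0) (k : ℕ) :
    iteratedFDeriv ℝ k (fun y => f y * g y) x = 0 := by
  have h := norm_iteratedFDeriv_mul_le (n := k) hf hg x (mod_cast le_top)
  have h' : ∑ i ∈ Finset.range (k + 1),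
      (k.choose i : ℝ) * ‖iteratedFDeriv ℝ i f x‖ * ‖iteratedFDeriv ℝ (k - i) g x‖ = 0 :=
    Finset.sum_eq_zero fun i _ => by rw [h0 i, norm_zero, mul_zero, zero_mul]
  exact norm_le_zero_iff.1 (h.trans h'.le)

/-- A product of smooth functions is flat at a point where the right factor is flat. [folklore] -/
theorem iteratedFDeriv_mul_eq_zero_of_right {X : Type*} [NormedAddCommGroup X] [NormedSpace ℝ X]
    {f g : X → ℂ} {x : X} (hf : ContDiff ℝ ∞ f) (hg : ContDiff ℝ ∞ g)
    (h0 : ∀ k, iteratedFDeriv ℝ k g x = 0) (k : ℕ) :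
    iteratedFDeriv ℝ k (fun y => f y * g y) x = 0 := by
  have hfun : (fun y => f y * g y) = fun y => g y * f y := funext fun y => mul_comm _ _
  rw [hfun]
  exact iteratedFDeriv_mul_eq_zero_of_left hg hf h0 k

/-- Flatness passes through precomposition with a continuous linear map. [folklore] -/
theorem iteratedFDeriv_comp_clm_eq_zero {X Y : Type*} [NormedAddCommGroup X] [NormedSpace ℝ X]
    [NormedAddCommGroup Y] [NormedSpace ℝ Y] (L : X →L[ℝ] Y) {f : Y → ℂ} (hf : ContDiff ℝ ∞ f) {x : X}
    (h0 : ∀ k, iteratedFDeriv ℝ k f (L x) = 0) (k : ℕ) : iteratedFDeriv ℝ k (f ∘ L) x = 0 := by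
  rw [L.iteratedFDeriv_comp_right hf x (mod_cast le_top), h0 k]
  ext v
  rw [ContinuousMultilinearMap.compContinuousLinearMap_apply]
  rfl

/-! ## `⁰𝒮` is stable under conjugation, permutations and the OS adjoint -/

/-- `⁰𝒮` is stable under pointwise complex conjugation. [folklore] -/
theorem isOffDiagonal_starTest {F : 𝓢((Fin n → E4), ℂ)} (hF : IsOffDiagonal F) :
    IsOffDiagonal (starTest F) := by
  intro x hx k
  have hfun : (starTest F : (Fin n → E4) → ℂ) = Complex.conjLIE ∘ (F : (Fin n → E4) → ℂ) := by
    funext y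
    simp
  rw [← norm_eq_zero, hfun, Complex.conjLIE.norm_iteratedFDeriv_comp_left, hF x hx k, norm_zero]

-- adapted from `…ParabolicTrajectoryContinuumLimitOnTrajectoryStubOSLegsB_Limit.isOffDiagonal_comp_equiv`
/-- Precomposition with a continuous linear equivalence preserving the coincidence locus preserves `⁰𝒮`.
[folklore] -/
theorem isOffDiagonal_comp_equiv {F F' : 𝓢((Fin n → E4), ℂ)} (g : (Fin n → E4) ≃L[ℝ] (Fin n → E4))
    (hg : ∀ x, x ∈ coincidenceLocus n E4 → g x ∈ coincidenceLocus n E4)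
    (hFg : ∀ x, F' x = F (g x)) (hF : IsOffDiagonal F) : IsOffDiagonal F' := by
  intro x hx k
  have hfun : (F' : (Fin n → E4) → ℂ) =
      (F : (Fin n → E4) → ℂ) ∘ ⇑(g : (Fin n → E4) →L[ℝ] (Fin n → E4)) := funext hFg
  rw [hfun]
  exact iteratedFDeriv_comp_clm_eq_zero _ (F.smooth ⊤) (fun k' => hF (g x) (hg x hx) k') k

-- adapted from `…ParabolicTrajectoryContinuumLimitOnTrajectoryStubOSLegsB_Limit.isOffDiagonal_permTest`
/-- `⁰𝒮` is stable under permutations of the arguments. [folklore] -/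
theorem isOffDiagonal_permTest {F : 𝓢((Fin n → E4), ℂ)} (hF : IsOffDiagonal F) (σ : Equiv.Perm (Fin n)) :
    IsOffDiagonal (permTest σ F) := by
  refine isOffDiagonal_comp_equiv ((LinearEquiv.funCongrLeft ℝ E4 σ).toContinuousLinearEquiv) ?_ ?_ hF
  · rintro x ⟨i, j, hij, h⟩
    refine ⟨σ.symm i, σ.symm j, fun h' => hij (σ.symm.injective h'), ?_⟩
    change x (σ (σ.symm i)) = x (σ (σ.symm j))
    simpa using h
  · intro x
    rw [permTest_apply]
    rfl

/-- `⁰𝒮` is stable under the OS adjoint `F ↦ ΘF*`. [folklore] -/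
theorem isOffDiagonal_osAdjoint {F : 𝓢((Fin n → E4), ℂ)} (hF : IsOffDiagonal F) :
    IsOffDiagonal (osAdjoint F) := by
  unfold osAdjoint thetaMulti
  exact isOffDiagonal_starTest (isOffDiagonal_linActMulti (isOffDiagonal_permTest hF _) _)

/-! ## OS tensors of off-diagonal positive-time functions are off-diagonal -/

/-- **Tensors of off-diagonal functions with time-separated supports are off-diagonal.** If `A ∈ ⁰𝒮ₙ` is supported
in `{∀ i, xᵢ⁰ < 0}` and `B ∈ ⁰𝒮ₘ` in `{∀ j, xⱼ⁰ > 0}`, then `A ⊗ B ∈ ⁰𝒮ₙ₊ₘ`: at a coincidence inside one block the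
corresponding factor is flat, and a coincidence across the blocks is off the support. [folklore] -/
theorem isOffDiagonal_appendTensor_of_separated {A : 𝓢((Fin n → E4), ℂ)} {B : 𝓢((Fin m → E4), ℂ)}
    (hAo : IsOffDiagonal A) (hBo : IsOffDiagonal B)
    (hA : tsupport (A : (Fin n → E4) → ℂ) ⊆ {x | ∀ i, x i 0 < 0})
    (hB : tsupport (B : (Fin m → E4) → ℂ) ⊆ {x | ∀ j, 0 < x j 0}) :
    IsOffDiagonal (A.appendTensor B) := by
  intro x hx k
  by_cases hxs : x ∈ tsupport ((A.appendTensor B : 𝓢((Fin (n + m) → E4), ℂ)) : (Fin (n + m) → E4) → ℂ)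
  · obtain ⟨h1, h2⟩ := OSReconstructionNoE1.tsupport_appendTensor_subset A B hxs
    have hneg : ∀ i, x (Fin.castAdd m i) 0 < 0 := hA h1
    have hpos : ∀ j, 0 < x (Fin.natAdd n j) 0 := hB h2
    set L₁ : (Fin (n + m) → E4) →L[ℝ] (Fin n → E4) := SchwartzMap.restrictCLM (Fin.castAdd m) with hL₁
    set L₂ : (Fin (n + m) → E4) →L[ℝ] (Fin m → E4) := SchwartzMap.restrictCLM (Fin.natAdd n) with hL₂
    have hfun : ((A.appendTensor B : 𝓢((Fin (n + m) → E4), ℂ)) : (Fin (n + m) → E4) → ℂ) =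
        fun y => ((A : (Fin n → E4) → ℂ) ∘ L₁) y * ((B : (Fin m → E4) → ℂ) ∘ L₂) y := rfl
    have hAs : ContDiff ℝ ∞ ((A : (Fin n → E4) → ℂ) ∘ L₁) := (A.smooth ⊤).comp L₁.contDiff
    have hBs : ContDiff ℝ ∞ ((B : (Fin m → E4) → ℂ) ∘ L₂) := (B.smooth ⊤).comp L₂.contDiff
    obtain ⟨p, q, hpq, hxpq⟩ := hx
    have ht : x p 0 = x q 0 := by rw [hxpq]
    rw [hfun]
    induction p using Fin.addCases with
    | left i =>
      induction q using Fin.addCases with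
      | left j =>
        refine iteratedFDeriv_mul_eq_zero_of_left hAs hBs
          (iteratedFDeriv_comp_clm_eq_zero _ (A.smooth ⊤) (fun k' => hAo _ ?_ k')) k
        exact ⟨i, j, fun h => hpq (by rw [h]), hxpq⟩
      | right j =>
        exfalso
        linarith [hneg i, hpos j]
    | right i =>
      induction q using Fin.addCases with
      | left j =>
        exfalso
        linarith [hpos i, hneg j]
      | right j =>
        refine iteratedFDeriv_mul_eq_zero_of_right hAs hBs
          (iteratedFDeriv_comp_clm_eq_zero _ (B.smooth ⊤) (fun k' => hBo _ ?_ k')) k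
        exact ⟨i, j, fun h => hpq (by rw [h]), hxpq⟩
  · by_contra hne
    exact hxs (support_iteratedFDeriv_subset k (Function.mem_support.mpr hne))

/-- The OS adjoint of a positive-time function is supported in `{∀ i, xᵢ⁰ < 0}` (`Θ𝒮₊ = 𝒮₋`). [folklore] -/
theorem tsupport_osAdjoint_subset_neg {A : 𝓢((Fin n → E4), ℂ)} (hA : IsPositiveTimeMulti A) :
    tsupport ((osAdjoint A : 𝓢((Fin n → E4), ℂ)) : (Fin n → E4) → ℂ) ⊆ {x | ∀ i, x i 0 < 0} := by
  intro x hx i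
  have h : ∀ j, 0 < (timeReflection 4 (x (Fin.rev j))) 0 := hA (OSReconstructionNoE1.tsupport_osAdjoint_subset A hx)
  have hi := h (Fin.rev i)
  simp only [timeReflection_apply, if_true, Fin.rev_rev] at hi
  linarith

/-- **OS tensors of off-diagonal positive-time functions are off-diagonal**: for `A ∈ ⁰𝒮ₙ`, `B ∈ ⁰𝒮ₘ` supported in
the UNORDERED positive-time region `{∀ i, xᵢ⁰ > 0}`, `ΘA* ⊗ B ∈ ⁰𝒮ₙ₊ₘ`. [folklore] -/
theorem isOffDiagonal_osAdjoint_appendTensor {A : 𝓢((Fin n → E4), ℂ)} {B : 𝓢((Fin m → E4), ℂ)}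
    (hA : IsPositiveTimeMulti A) (hAo : IsOffDiagonal A) (hB : IsPositiveTimeMulti B) (hBo : IsOffDiagonal B) :
    IsOffDiagonal ((osAdjoint A).appendTensor B) :=
  isOffDiagonal_appendTensor_of_separated (isOffDiagonal_osAdjoint hAo) hBo (tsupport_osAdjoint_subset_neg hA) hB

/-! ## E3 transport of the OS pairing -/

/-- `Θ(A^σ)* = (ΘA*)^{rev ∘ σ ∘ rev}`: the OS adjoint of a permuted test function. [folklore] -/
theorem osAdjoint_permTest (σ : Equiv.Perm (Fin n)) (A : 𝓢((Fin n → E4), ℂ)) :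
    osAdjoint (permTest σ A) = permTest (Fin.revPerm.trans (σ.trans Fin.revPerm)) (osAdjoint A) := by
  ext x
  simp [osAdjoint_apply, permTest_apply, Function.comp_def, Fin.rev_rev]

/-- `A^σ ⊗ B^τ = (A ⊗ B)^{σ ⊕ τ}`: tensor product of permuted test functions. [folklore] -/
theorem appendTensor_permTest (σ : Equiv.Perm (Fin n)) (τ : Equiv.Perm (Fin m)) (A : 𝓢((Fin n → E4), ℂ))
    (B : 𝓢((Fin m → E4), ℂ)) :
    (permTest σ A).appendTensor (permTest τ B) =
      permTest (finSumFinEquiv.permCongr (σ.sumCongr τ)) (A.appendTensor B) := by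
  ext x
  simp only [SchwartzMap.appendTensor_apply, permTest_apply]
  congr 1
  · congr 1
    funext i
    simp [Equiv.permCongr_apply]
  · congr 1
    funext j
    simp [Equiv.permCongr_apply]

/-- **E3 transport of the OS pairing**: if `ΘA* ⊗ B ∈ ⁰𝒮`, then `⟪A^σ, B^τ⟫_S = ⟪A, B⟫_S` for a family with E3
(symmetry on `⁰𝒮`). [folklore] -/
theorem osPairing_permTest (S : SchwingerFamily E4) (hE3 : S.toLabelled.IsSymmetric)
    {A : 𝓢((Fin n → E4), ℂ)} {B : 𝓢((Fin m → E4), ℂ)} (hoff : IsOffDiagonal ((osAdjoint A).appendTensor B))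
    (σ : Equiv.Perm (Fin n)) (τ : Equiv.Perm (Fin m)) :
    S.osPairing (permTest σ A) (permTest τ B) = S.osPairing A B := by
  simp only [SchwingerFamily.osPairing]
  rw [osAdjoint_permTest, appendTensor_permTest]
  have h := hE3 (n + m) (fun _ => ())
    (finSumFinEquiv.permCongr ((Fin.revPerm.trans (σ.trans Fin.revPerm)).sumCongr τ))
    ((osAdjoint A).appendTensor B) hoff
  simpa using h

/-- Sesquilinearity of the OS pairing on plain finite sums. [folklore] -/
theorem osPairing_sum_sum (S : SchwingerFamily E4) {ι κ : Type*} (s : Finset ι) (t : Finset κ)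
    (A : ι → 𝓢((Fin n → E4), ℂ)) (B : κ → 𝓢((Fin m → E4), ℂ)) :
    S.osPairing (∑ i ∈ s, A i) (∑ j ∈ t, B j) = ∑ i ∈ s, ∑ j ∈ t, S.osPairing (A i) (B j) := by
  have h := S.osPairing_sum_smul s t (fun _ => 1) (fun _ => 1) A B
  simpa using h

end UnorderedRP

/-- **Registered sub-goal of stub `stub_unorderedRP` (helpers, part I)**: for a one-species family with E3 on `⁰𝒮`
and off-diagonal positive-time (UNORDERED `𝒮₊`) test functions `A` (`n` points), `B` (`m` points), the OS tensor
`ΘA* ⊗ B` lies in `⁰𝒮ₙ₊ₘ` and the OS pairing is invariant under separate permutations of the arguments of `A` and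
`B`: `𝔖ₙ₊ₘ(Θ(A^σ)* ⊗ B^τ) = 𝔖ₙ₊ₘ(ΘA* ⊗ B)`. [folklore] -/
theorem unorderedRPTransport :
    open Literature.MathematicalPhysics.QuantumLattice Literature.MathematicalPhysics.AQFT
      Summit.QuantumFields.YangMills.Theorems.NPointIsotropy.Negative in
    ∀ (S₁ : SchwingerFamily E4), S₁.toLabelled.IsSymmetric →
      ∀ (n m : ℕ) (A : SchwartzMap (Fin n → E4) ℂ) (B : SchwartzMap (Fin m → E4) ℂ),
        IsPositiveTimeMulti A → IsOffDiagonal A → IsPositiveTimeMulti B → IsOffDiagonal B →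
          IsOffDiagonal ((osAdjoint A).appendTensor B) ∧
            ∀ (σ : Equiv.Perm (Fin n)) (τ : Equiv.Perm (Fin m)),
              S₁.osPairing (permTest σ A) (permTest τ B) = S₁.osPairing A B := by
  intro S₁ hE3 n m A B hA hAo hB hBo
  have hoff := UnorderedRP.isOffDiagonal_osAdjoint_appendTensor hA hAo hB hBo
  exact ⟨hoff, fun σ τ => UnorderedRP.osPairing_permTest S₁ hE3 hoff σ τ⟩

end Summit.QuantumFields.YangMills.Theorems.NPointIsotropy.QuarterTurnCornerOperator

end
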